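import Summits.PneNP.PneNP.Theorems.SoloInformedIOShape
import Literature.Computability.Complexity.LogAdviceCollapse
import HarnessLib

/-!
# `P ≠ NP` is robust under logarithmic advice

Summit-side corollaries of the Karp–Lipton `P/log` theorem
(`Literature/Computability/Complexity/LogAdviceCollapse.lean`: `NP ⊆ P/log ↔ NP ⊆ P`), recorded
as facts about the SHAPE of the summit statement `PneNP` for the soloist's deliverable
("what a proof must do"): separating `NP` from `P` is *the same task* as separating it from
polynomial time with `O(log n)` bits of non-uniform advice, and — for the length-paddable complete
problem `onesZeroPad SAT = {1ⁱ0φ : φ ∈ SAT}` — the same as showing that this one language has no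
`P/log` algorithm. The margin is sharp in the tree: with polynomial advice only the collapse
`NP ⊆ P/poly → PH = Σ₂ᵖ` is available (`KarpLipton.lean`), not `P = NP`.

"`T ∈ P/log`" is written out, as in the Literature file:
`∃ T' ∈ P, ∃ a : ℕ → {0,1}*, ∃ c, (∀ n, |a n| ≤ c·⌊log₂ n⌋ + c) ∧ ∀ y, (y ∈ T ↔ ⟨y, a |y|⟩ ∈ T')`.

References: R. M. Karp, R. J. Lipton, *Some connections between nonuniform and uniform complexity
classes*, STOC 1980, doi:10.1145/800141.804678 [KarpLipton1980]; S. Homer, A. L. Selman,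
*Computability and Complexity Theory*, 2nd ed. (2011), Homework 8.13; S. Arora, B. Barak (2009),
Def. 6.16 [AroraBarak2009].
-/

namespace Summit.PneNP.PneNP.Theorems

open Literature.Computability.Complexity Literature.Computability.MetaComplexity _root_.Computability

/-- **`P ≠ NP ↔ NP ⊄ P/log`.** [cite: KarpLipton1980, §6 (P/log)] -/
theorem soloInformed_pneNP_iff_not_NP_subset_logAdvice :
    PneNP ↔ ¬ ∀ L ∈ Nondeterministic.NP, ∃ L' ∈ Classes.P, ∃ a : ℕ → List Bool, ∃ c : ℕ,
      (∀ n, (a n).length ≤ c * Nat.log 2 n + c) ∧ ∀ x, x ∈ L ↔ boolPair x (a x.length) ∈ L' := by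
  rw [soloInformed_pneNP_iff_exists_not_mem, ← Set.not_subset]
  exact (not_congr NP_subset_logAdvice_iff).symm

/-- **`P ≠ NP ↔ onesZeroPad SAT ∉ P/log`**: the summit is the statement that ONE explicit
length-paddable `NP`-complete language has no polynomial-time algorithm with `O(log n)` advice.
[cite: KarpLipton1980, §6 (P/log)] -/
theorem soloInformed_pneNP_iff_padSAT_not_mem_logAdvice :
    PneNP ↔ ¬ ∃ T' ∈ Classes.P, ∃ a : ℕ → List Bool, ∃ c : ℕ,
      (∀ n, (a n).length ≤ c * Nat.log 2 n + c) ∧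
        ∀ y, y ∈ onesZeroPad SAT ↔ boolPair y (a y.length) ∈ T' := by
  rw [soloInformed_pneNP_iff_exists_not_mem, ← Set.not_subset]
  exact (not_congr onesZeroPad_SAT_mem_logAdvice_iff).symm

/-- **`P ≠ NP ↔` no `NP`-complete length-paddable language is in `P/log`.**
[cite: KarpLipton1980, §6 (P/log)] -/
theorem soloInformed_pneNP_iff_complete_paddable_not_mem_logAdvice :
    PneNP ↔ ∀ T : Language Bool, IsNPComplete T → IsLengthPaddable T →
      ¬ ∃ T' ∈ Classes.P, ∃ a : ℕ → List Bool, ∃ c : ℕ,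
        (∀ n, (a n).length ≤ c * Nat.log 2 n + c) ∧
          ∀ y, y ∈ T ↔ boolPair y (a y.length) ∈ T' := by
  rw [soloInformed_pneNP_iff_exists_not_mem, ← Set.not_subset]
  constructor
  · intro h T hT hpad hlog
    exact h ((mem_logAdvice_iff_of_isNPComplete_lengthPaddable hT hpad).1 hlog)
  · intro h hNP
    exact h _ (isNPComplete_onesZeroPad isNPComplete_SAT_holds) (isLengthPaddable_onesZeroPad SAT)
      (onesZeroPad_SAT_mem_logAdvice_iff.2 hNP)

end Summit.PneNP.PneNP.Theorems
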